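import Summits.Ventures.PercRepro.GenQNearEndPiecesGenB
import Summits.Ventures.PercRepro.Night4T6C9Q7M0Z

/-!
# PercRepro — the type-`6`, corank-`9` near-end case of `HighLayersSevenResidue` from its pieces (night-4, gen 10)

`jq_t6_c9_near_end`: the branch certificate `jq_t6_nonneg_c9_q7_m0` (no hyperplane trace of `≥ 14` of the `16` points, kernel) and the (β₂) piece at type `6` — `hypAddTwoProfile ≥ 0` on every rank-`6` set of `14` points with two points outside its closure — give the type-`6` balance on every coloop-free rank-`7` set of `16` points (`jq_succ_of_two_pieces_type` at `q = 6`).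
-/
namespace PercRepro.GenQ

open Finset ThmH SixFour PerFlat Star

variable {α : Type*} [DecidableEq α] {M : Matroid α} [M.Finite]

/-- **The type-`6`, corank-`9` case from the branch certificate and the named pieces.** -/
theorem jq_t6_c9_near_end (hs : Simple M) (hline : ∀ L ∈ flatsQ M 2, L.card ≤ 3)
    (hplane : ∀ P ∈ flatsQ M 3, P.card ≤ 6) (hsolid : ∀ F ∈ flatsQ M 4, F.card ≤ 10)
    (hflat5 : ∀ F ∈ flatsQ M 5, F.card ≤ 21) (hflat6 : ∀ F ∈ flatsQ M 6, F.card ≤ 43)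
    (htwo : ∀ (τ : Finset α) (a a' : α), τ ⊆ gr M → M.eRk (τ : Set α) = ((6 : ℕ) : ℕ∞) → τ.card + 2 = 16 →
      a ∈ gr M → a' ∈ gr M → a ≠ a' → a ∉ τ → a' ∉ τ → a ∉ M.closure (τ : Set α) → a' ∉ M.closure (τ : Set α) →
      M.eRk ((insert a (insert a' τ) : Finset α) : Set α) = ((6 : ℕ) : ℕ∞) + 1 → 0 ≤ hypAddTwoProfile M τ a a' 6 6)
    {G : Finset α} (hG : G ⊆ gr M) (hrG : M.eRk (G : Set α) = ((7 : ℕ) : ℕ∞)) (hcard : G.card = 7 + 9)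
    (hmG : mTr M G = 0) : 0 ≤ Jq M G 7 6 :=
  jq_succ_of_two_pieces_type (q := 6) (n := 16) (t := 6) (by norm_num) (by norm_num)
    (fun G' hG' hrG' hcard' hmG' hbig =>
      Night4.jq_t6_nonneg_c9_q7_m0 hs hline hplane hsolid hflat5 hflat6 hG' hrG' hcard' hmG' hbig)
    htwo G hG hrG hcard hmG

end PercRepro.GenQ
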